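import Literature.NumberTheory.EllipticCurves.TwoIsogenyLocalImageNode
import Literature.NumberTheory.NumberFields.AdicCompletionResidueHom
import Mathlib.NumberTheory.NumberField.Basic
import HarnessLib

/-!
# The local condition of a `2`-isogeny descent at a nodal place of a number field, as a congruence

Topic `NumberTheory/EllipticCurves`. Let `K` be a number field, `v` a finite place with a residue map
`ψ : 𝓞 K → R` (surjective, kernel `v`; e.g. `R = ℤ/ℓ` at a place of degree one), and `W : y² = x³ + ax² + bx` over
`K` in two-torsion normal form with `x² + ax + b = (x - c)² - e`, where `n c = c₀`, `n² e = e₀` for global integers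
`c₀, e₀ ∈ 𝓞 K`, an integer `n` (to allow `c = -a/2 ∉ 𝓞 K`), `n, c₀ ∉ v` and `e₀ ∈ v` (NODAL place: the two
`2`-torsion points `≠ T` collide mod `v`). The local condition "`[d]_{K_v} ∈ α(W(K_v))`" of the `2`-isogeny Selmer
group (Silverman *AEC* X.4.9; tree `TwoIsogenySelmerGroupShaNF`) for a `v`-unit `d ∈ 𝓞 K` then forces a congruence:

* `WeierstrassCurve.residue_sq_or_of_sqClass_mem_range_node` — **`ψ(d) = r²` or `ψ(d) ψ(c₀) ψ(n) = r²`** with `r ∈ Rˣ`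
  (the local image is `{[1 + m]} ∪ {[c(1 + m)]}`, tree `xSqClass_eq_sqClass_one_add_or`, read through the residue map
  `ρ : O_v → R` extending `ψ`, tree `exists_ringHom_adicCompletionIntegers_extending'`);
* `WeierstrassCurve.residue_sq_of_sqClass_mem_range_node_of_odd` — **`ψ(d) = r²`** when moreover `ord_v(e₀)` is odd
  (tree `xSqClass_eq_sqClass_one_add_of_odd`).

So at such a place the Legendre symbol of `ψ(d)` (times that of `ψ(n c₀)` in the first case, when `ψ(n c₀)` is a
non-residue) is an `𝔽₂`-linear functional killing Selmer candidates — the mechanism of every complete `2`-isogeny descent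
at the multiplicative places (Silverman *AEC* X.4.9–X.4.10). Theorems only; no named facts.

## References
* [SilvermanAEC2009] J. H. Silverman, *The Arithmetic of Elliptic Curves*, 2nd ed. (2009), Prop. X.4.9, Example X.4.10.
* [Serre1979] J.-P. Serre, *Local Fields* (1979), II §1 (residue field of the completion).
-/

noncomputable section

open scoped Classical NumberField
open IsDedekindDomain NumberField

namespace WeierstrassCurve

open _root_.WeierstrassCurve.Affine Literature.NumberTheory.NumberFields

universe u

variable {K : Type u} [Field K] [NumberField K]

/-- From `[a] = [b]` in `Lˣ/Lˣ²` (`a, b ≠ 0`): `a b` is a square. [cite: SilvermanAEC2009, Prop. X.4.9] -/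
private theorem exists_mul_eq_sq_of_sqClass_eq {L : Type*} [Field L] {a b : L} (ha : a ≠ 0) (hb : b ≠ 0)
    (h : sqClass a = sqClass b) : ∃ z : L, a * b = z ^ 2 := by
  have h1 : sqClass (a * b) = 1 := by rw [sqClass_mul ha hb, h, SqUnits.mul_self]
  exact (sqClass_eq_one_iff (mul_ne_zero ha hb)).mp h1

variable {R : Type*} [CommRing R] (ψ : 𝓞 K →+* R) (hψ : Function.Surjective ψ)
  (v : HeightOneSpectrum (𝓞 K)) (hker : RingHom.ker ψ = v.asIdeal)
  (W : WeierstrassCurve K) [W.IsTwoTorsionNF] {c e : K} (ha : W.a₂ = -2 * c) (hb : W.a₄ = c ^ 2 - e)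
  {n : ℤ} {c₀ e₀ : 𝓞 K} (hnc : (n : K) * c = algebraMap (𝓞 K) K c₀) (hne : (n : K) ^ 2 * e = algebraMap (𝓞 K) K e₀)
  (hn : (n : 𝓞 K) ∉ v.asIdeal) (hc₀ : c₀ ∉ v.asIdeal) (he₀ : e₀ ∈ v.asIdeal)

include hψ hker ha hb hnc hne hn hc₀ he₀

/-- **The local condition at a nodal place, as a congruence.** With the notation of the module docstring
(`W : y² = x((x - c)² - e)`, `n c = c₀`, `n² e = e₀`, `n, c₀ ∉ v`, `e₀ ∈ v`, `ψ : 𝓞 K ↠ R` with kernel `v`): if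
`d ∈ 𝓞 K ∖ v` has `[d]_{K_v} ∈ α(W(K_v))`, then `ψ(d) = r²` or `ψ(d) ψ(c₀) ψ(n) = r²` for a unit `r` of `R`.
[cite: SilvermanAEC2009, Prop. X.4.9] -/
theorem residue_sq_or_of_sqClass_mem_range_node {d : 𝓞 K} (hd : d ∉ v.asIdeal)
    (hmem : sqClass (algebraMap K (v.adicCompletion K) (algebraMap (𝓞 K) K d)) ∈
      Set.range (W.baseChange (v.adicCompletion K)).xSqClass) :
    ∃ r : R, IsUnit r ∧ (ψ d = r ^ 2 ∨ ψ d * ψ c₀ * ψ n = r ^ 2) := by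
  -- notation and the residue map `ρ : O_v → R`
  obtain ⟨ρ, hρ, hρ0⟩ := exists_ringHom_adicCompletionIntegers_extending' K v ψ hψ hker
  have hval : ∀ x : K, Valued.v (algebraMap K (v.adicCompletion K) x) = v.valuation K x := fun x =>
    HeightOneSpectrum.valuedAdicCompletion_eq_valuation' v x
  have hvO : ∀ a : 𝓞 K, a ∉ v.asIdeal → v.valuation K (algebraMap (𝓞 K) K a) = 1 := fun a h =>
    (HeightOneSpectrum.valuation_eq_one_iff_notMem v).mpr h
  have hunit : ∀ a : 𝓞 K, a ∉ v.asIdeal → IsUnit (algebraMap (𝓞 K) (v.adicCompletionIntegers K) a) := by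
    intro a h
    rw [HeightOneSpectrum.adicCompletionIntegers.isUnit_iff_valued_eq_one, coe_algebraMap_adicCompletionIntegers_eq,
      hval]
    exact hvO a h
  have hn0 : (n : K) ≠ 0 := by
    intro h0
    have h1 := hvO (n : 𝓞 K) hn
    rw [map_intCast, h0, map_zero] at h1
    exact zero_ne_one h1
  have hvn : v.valuation K (n : K) = 1 := by rw [← map_intCast (algebraMap (𝓞 K) K) n]; exact hvO _ hn
  have hc : c = algebraMap (𝓞 K) K c₀ / n := by rw [← hnc]; field_simp
  have he : e = algebraMap (𝓞 K) K e₀ / n ^ 2 := by rw [← hne]; field_simp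
  -- hypotheses of the nodal lemma for `W ⊗ K_v`
  haveI : (W.baseChange (v.adicCompletion K)).IsTwoTorsionNF :=
    ⟨by rw [show (W.baseChange (v.adicCompletion K)).a₁ = algebraMap K (v.adicCompletion K) W.a₁ from rfl, a₁_of_isTwoTorsionNF, map_zero],
     by rw [show (W.baseChange (v.adicCompletion K)).a₃ = algebraMap K (v.adicCompletion K) W.a₃ from rfl, a₃_of_isTwoTorsionNF, map_zero],
     by rw [show (W.baseChange (v.adicCompletion K)).a₆ = algebraMap K (v.adicCompletion K) W.a₆ from rfl, a₆_of_isTwoTorsionNF, map_zero]⟩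
  have ha' : (W.baseChange (v.adicCompletion K)).a₂ = -2 * algebraMap K (v.adicCompletion K) c := by
    rw [show (W.baseChange (v.adicCompletion K)).a₂ = algebraMap K (v.adicCompletion K) W.a₂ from rfl, ha, map_mul, map_neg, map_ofNat]
  have hb' : (W.baseChange (v.adicCompletion K)).a₄ = algebraMap K (v.adicCompletion K) c ^ 2 - algebraMap K (v.adicCompletion K) e := by
    rw [show (W.baseChange (v.adicCompletion K)).a₄ = algebraMap K (v.adicCompletion K) W.a₄ from rfl, hb, map_sub, map_pow]
  have hc' : Valued.v (algebraMap K (v.adicCompletion K) c) = 1 := by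
    rw [hval, hc, map_div₀, hvO c₀ hc₀, hvn, div_one]
  have he' : Valued.v (algebraMap K (v.adicCompletion K) e) < 1 := by
    rw [hval, he, map_div₀, map_pow, hvn, one_pow, div_one]
    exact (HeightOneSpectrum.valuation_lt_one_iff_mem _ _).mpr he₀
  have hdL0 : algebraMap K (v.adicCompletion K) (algebraMap (𝓞 K) K d) ≠ 0 := by
    intro h0
    have h1 := hval (algebraMap (𝓞 K) K d)
    rw [h0, map_zero, hvO d hd] at h1
    exact zero_ne_one h1
  obtain ⟨P, hP⟩ := hmem
  -- membership of local units in `O_v` and their residues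
  have memO : ∀ m : v.adicCompletion K, Valued.v m < 1 → m ∈ v.adicCompletionIntegers K := fun m hm =>
    (HeightOneSpectrum.mem_adicCompletionIntegers _ _ _).mpr hm.le
  have coeO : ∀ (m : v.adicCompletion K) (hm : Valued.v m < 1),
      (((1 : v.adicCompletionIntegers K) + ⟨m, memO m hm⟩ : v.adicCompletionIntegers K) : v.adicCompletion K) =
        1 + m := fun m hm => by push_cast; rfl
  have unitO : ∀ (m : v.adicCompletion K) (hm : Valued.v m < 1),
      IsUnit ((1 : v.adicCompletionIntegers K) + ⟨m, memO m hm⟩) := by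
    intro m hm
    rw [HeightOneSpectrum.adicCompletionIntegers.isUnit_iff_valued_eq_one]
    change Valued.v ((((1 : v.adicCompletionIntegers K) + ⟨m, memO m hm⟩ : v.adicCompletionIntegers K) :
      v.adicCompletion K)) = 1
    rw [coeO m hm, Valuation.map_add_eq_of_lt_left _ (by rwa [map_one]), map_one]
  have resO : ∀ (m : v.adicCompletion K) (hm : Valued.v m < 1),
      ρ ((1 : v.adicCompletionIntegers K) + ⟨m, memO m hm⟩) = 1 := by
    intro m hm
    rw [map_add, map_one, (hρ0 ⟨m, memO m hm⟩).mpr hm, add_zero]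
  rcases xSqClass_eq_sqClass_one_add_or ha' hb' hc' he' P with ⟨m, hm, hPm⟩ | ⟨m, hm, hPm⟩
  · -- `[d] = [1 + m]`: `ψ d = r²`
    rw [hP] at hPm
    have h1m : (1 + m : v.adicCompletion K) ≠ 0 := fun h => by
      have := unitO m hm
      rw [HeightOneSpectrum.adicCompletionIntegers.isUnit_iff_valued_eq_one] at this
      have h' := coeO m hm
      rw [h] at h'
      rw [show ((((1 : v.adicCompletionIntegers K) + ⟨m, memO m hm⟩ : v.adicCompletionIntegers K) :
        v.adicCompletion K)) = 0 from h', map_zero] at this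
      exact zero_ne_one this
    obtain ⟨z, hz⟩ := exists_mul_eq_sq_of_sqClass_eq hdL0 h1m hPm
    have hz' : ((algebraMap (𝓞 K) (v.adicCompletionIntegers K) d : v.adicCompletionIntegers K) : v.adicCompletion K) *
        ((((1 : v.adicCompletionIntegers K) + ⟨m, memO m hm⟩ : v.adicCompletionIntegers K) : v.adicCompletion K)) =
          z ^ 2 := by
      rw [coe_algebraMap_adicCompletionIntegers_eq, coeO m hm]; exact hz
    obtain ⟨r, hr, hrr⟩ := residue_mul_eq_sq_of_mul_eq_sq K v ρ (hunit d hd) (unitO m hm) hz'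
    rw [hρ, resO m hm, mul_one] at hrr
    exact ⟨r, hr, Or.inl hrr⟩
  · -- `[d] = [c(1 + m)]`: `ψ d ψ c₀ ψ n = (r ψ n)²`
    rw [hP] at hPm
    have hcL0 : algebraMap K (v.adicCompletion K) c ≠ 0 := fun h => by rw [h, map_zero] at hc'; exact zero_ne_one hc'
    have h1m : (1 + m : v.adicCompletion K) ≠ 0 := fun h => by
      have := unitO m hm
      rw [HeightOneSpectrum.adicCompletionIntegers.isUnit_iff_valued_eq_one] at this
      have h' := coeO m hm
      rw [h] at h'
      rw [show ((((1 : v.adicCompletionIntegers K) + ⟨m, memO m hm⟩ : v.adicCompletionIntegers K) :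
        v.adicCompletion K)) = 0 from h', map_zero] at this
      exact zero_ne_one this
    obtain ⟨z, hz⟩ := exists_mul_eq_sq_of_sqClass_eq hdL0 (mul_ne_zero hcL0 h1m) hPm
    have memC : algebraMap K (v.adicCompletion K) c ∈ v.adicCompletionIntegers K := by
      rw [HeightOneSpectrum.mem_adicCompletionIntegers]; exact hc'.le
    set cO : v.adicCompletionIntegers K := ⟨algebraMap K (v.adicCompletion K) c, memC⟩ with hcO
    have hcOu : IsUnit cO := by
      rw [HeightOneSpectrum.adicCompletionIntegers.isUnit_iff_valued_eq_one]; exact hc'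
    have hsu : IsUnit (cO * ((1 : v.adicCompletionIntegers K) + ⟨m, memO m hm⟩)) := hcOu.mul (unitO m hm)
    have hz' : ((algebraMap (𝓞 K) (v.adicCompletionIntegers K) d : v.adicCompletionIntegers K) : v.adicCompletion K) *
        ((cO * ((1 : v.adicCompletionIntegers K) + ⟨m, memO m hm⟩) : v.adicCompletionIntegers K) :
          v.adicCompletion K) = z ^ 2 := by
      rw [coe_algebraMap_adicCompletionIntegers_eq]
      push_cast
      exact hz
    obtain ⟨r, hr, hrr⟩ := residue_mul_eq_sq_of_mul_eq_sq K v ρ (hunit d hd) hsu hz'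
    rw [hρ, map_mul, resO m hm, mul_one] at hrr
    -- `ψ n · ρ(c) = ψ c₀`
    have hncO : algebraMap (𝓞 K) (v.adicCompletionIntegers K) (n : 𝓞 K) * cO =
        algebraMap (𝓞 K) (v.adicCompletionIntegers K) c₀ := by
      apply Subtype.ext
      change ((algebraMap (𝓞 K) (v.adicCompletionIntegers K) (n : 𝓞 K) : v.adicCompletionIntegers K) : v.adicCompletion K) *
          algebraMap K (v.adicCompletion K) c = ((algebraMap (𝓞 K) (v.adicCompletionIntegers K) c₀ : v.adicCompletionIntegers K) : v.adicCompletion K)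
      rw [coe_algebraMap_adicCompletionIntegers_eq, coe_algebraMap_adicCompletionIntegers_eq, map_intCast,
        ← hnc, map_mul, map_intCast]
    have hρc : ψ (n : 𝓞 K) * ρ cO = ψ c₀ := by rw [← hρ, ← hρ, ← map_mul, hncO]
    have hnu : IsUnit (ψ (n : 𝓞 K)) := by rw [← hρ]; exact (hunit _ hn).map ρ
    refine ⟨r * ψ (n : 𝓞 K), hr.mul hnu, Or.inr ?_⟩
    rw [map_intCast] at hρc hnu ⊢
    calc ψ d * ψ c₀ * (n : R) = ψ d * ((n : R) * ρ cO) * (n : R) := by rw [hρc]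
      _ = ψ d * ρ cO * (n : R) ^ 2 := by ring
      _ = (r * (n : R)) ^ 2 := by rw [hrr]; ring

/-- **The local condition at a nodal place with `ord_v(e₀)` odd**: then `ψ(d) = r²` with `r ∈ Rˣ` — the local image
is the trivial coset on `v`-units, so `d` must be a quadratic residue at `v`. [cite: SilvermanAEC2009, Prop. X.4.9] -/
theorem residue_sq_of_sqClass_mem_range_node_of_odd
    (hodd : ¬ (2 : ℤ) ∣ WithZero.log (v.valuation K (algebraMap (𝓞 K) K e₀))) {d : 𝓞 K} (hd : d ∉ v.asIdeal)
    (hmem : sqClass (algebraMap K (v.adicCompletion K) (algebraMap (𝓞 K) K d)) ∈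
      Set.range (W.baseChange (v.adicCompletion K)).xSqClass) :
    ∃ r : R, IsUnit r ∧ ψ d = r ^ 2 := by
  obtain ⟨ρ, hρ, hρ0⟩ := exists_ringHom_adicCompletionIntegers_extending' K v ψ hψ hker
  have hval : ∀ x : K, Valued.v (algebraMap K (v.adicCompletion K) x) = v.valuation K x := fun x =>
    HeightOneSpectrum.valuedAdicCompletion_eq_valuation' v x
  have hvO : ∀ a : 𝓞 K, a ∉ v.asIdeal → v.valuation K (algebraMap (𝓞 K) K a) = 1 := fun a h =>
    (HeightOneSpectrum.valuation_eq_one_iff_notMem v).mpr h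
  have hunit : ∀ a : 𝓞 K, a ∉ v.asIdeal → IsUnit (algebraMap (𝓞 K) (v.adicCompletionIntegers K) a) := by
    intro a h
    rw [HeightOneSpectrum.adicCompletionIntegers.isUnit_iff_valued_eq_one, coe_algebraMap_adicCompletionIntegers_eq,
      hval]
    exact hvO a h
  have hn0 : (n : K) ≠ 0 := by
    intro h0
    have h1 := hvO (n : 𝓞 K) hn
    rw [map_intCast, h0, map_zero] at h1
    exact zero_ne_one h1
  have hvn : v.valuation K (n : K) = 1 := by rw [← map_intCast (algebraMap (𝓞 K) K) n]; exact hvO _ hn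
  have hc : c = algebraMap (𝓞 K) K c₀ / n := by rw [← hnc]; field_simp
  have he : e = algebraMap (𝓞 K) K e₀ / n ^ 2 := by rw [← hne]; field_simp
  haveI : (W.baseChange (v.adicCompletion K)).IsTwoTorsionNF :=
    ⟨by rw [show (W.baseChange (v.adicCompletion K)).a₁ = algebraMap K (v.adicCompletion K) W.a₁ from rfl, a₁_of_isTwoTorsionNF, map_zero],
     by rw [show (W.baseChange (v.adicCompletion K)).a₃ = algebraMap K (v.adicCompletion K) W.a₃ from rfl, a₃_of_isTwoTorsionNF, map_zero],
     by rw [show (W.baseChange (v.adicCompletion K)).a₆ = algebraMap K (v.adicCompletion K) W.a₆ from rfl, a₆_of_isTwoTorsionNF, map_zero]⟩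
  have ha' : (W.baseChange (v.adicCompletion K)).a₂ = -2 * algebraMap K (v.adicCompletion K) c := by
    rw [show (W.baseChange (v.adicCompletion K)).a₂ = algebraMap K (v.adicCompletion K) W.a₂ from rfl, ha, map_mul, map_neg, map_ofNat]
  have hb' : (W.baseChange (v.adicCompletion K)).a₄ = algebraMap K (v.adicCompletion K) c ^ 2 - algebraMap K (v.adicCompletion K) e := by
    rw [show (W.baseChange (v.adicCompletion K)).a₄ = algebraMap K (v.adicCompletion K) W.a₄ from rfl, hb, map_sub, map_pow]
  have hc' : Valued.v (algebraMap K (v.adicCompletion K) c) = 1 := by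
    rw [hval, hc, map_div₀, hvO c₀ hc₀, hvn, div_one]
  have hve : Valued.v (algebraMap K (v.adicCompletion K) e) = v.valuation K (algebraMap (𝓞 K) K e₀) := by
    rw [hval, he, map_div₀, map_pow, hvn, one_pow, div_one]
  have he' : Valued.v (algebraMap K (v.adicCompletion K) e) < 1 := by
    rw [hve]; exact (HeightOneSpectrum.valuation_lt_one_iff_mem _ _).mpr he₀
  have hodd' : ¬ (2 : ℤ) ∣ WithZero.log (Valued.v (algebraMap K (v.adicCompletion K) e)) := by rwa [hve]
  have hdL0 : algebraMap K (v.adicCompletion K) (algebraMap (𝓞 K) K d) ≠ 0 := by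
    intro h0
    have h1 := hval (algebraMap (𝓞 K) K d)
    rw [h0, map_zero, hvO d hd] at h1
    exact zero_ne_one h1
  obtain ⟨P, hP⟩ := hmem
  have memO : ∀ m : v.adicCompletion K, Valued.v m < 1 → m ∈ v.adicCompletionIntegers K := fun m hm =>
    (HeightOneSpectrum.mem_adicCompletionIntegers _ _ _).mpr hm.le
  have coeO : ∀ (m : v.adicCompletion K) (hm : Valued.v m < 1),
      (((1 : v.adicCompletionIntegers K) + ⟨m, memO m hm⟩ : v.adicCompletionIntegers K) : v.adicCompletion K) =
        1 + m := fun m hm => by push_cast; rfl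
  have unitO : ∀ (m : v.adicCompletion K) (hm : Valued.v m < 1),
      IsUnit ((1 : v.adicCompletionIntegers K) + ⟨m, memO m hm⟩) := by
    intro m hm
    rw [HeightOneSpectrum.adicCompletionIntegers.isUnit_iff_valued_eq_one]
    change Valued.v ((((1 : v.adicCompletionIntegers K) + ⟨m, memO m hm⟩ : v.adicCompletionIntegers K) :
      v.adicCompletion K)) = 1
    rw [coeO m hm, Valuation.map_add_eq_of_lt_left _ (by rwa [map_one]), map_one]
  have resO : ∀ (m : v.adicCompletion K) (hm : Valued.v m < 1),
      ρ ((1 : v.adicCompletionIntegers K) + ⟨m, memO m hm⟩) = 1 := by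
    intro m hm
    rw [map_add, map_one, (hρ0 ⟨m, memO m hm⟩).mpr hm, add_zero]
  obtain ⟨m, hm, hPm⟩ := xSqClass_eq_sqClass_one_add_of_odd ha' hb' hc' he' hodd' P
  rw [hP] at hPm
  have h1m : (1 + m : v.adicCompletion K) ≠ 0 := fun h => by
    have := unitO m hm
    rw [HeightOneSpectrum.adicCompletionIntegers.isUnit_iff_valued_eq_one] at this
    have h' := coeO m hm
    rw [h] at h'
    rw [show ((((1 : v.adicCompletionIntegers K) + ⟨m, memO m hm⟩ : v.adicCompletionIntegers K) :
      v.adicCompletion K)) = 0 from h', map_zero] at this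
    exact zero_ne_one this
  obtain ⟨z, hz⟩ := exists_mul_eq_sq_of_sqClass_eq hdL0 h1m hPm
  have hz' : ((algebraMap (𝓞 K) (v.adicCompletionIntegers K) d : v.adicCompletionIntegers K) : v.adicCompletion K) *
      ((((1 : v.adicCompletionIntegers K) + ⟨m, memO m hm⟩ : v.adicCompletionIntegers K) : v.adicCompletion K)) =
        z ^ 2 := by
    rw [coe_algebraMap_adicCompletionIntegers_eq, coeO m hm]; exact hz
  obtain ⟨r, hr, hrr⟩ := residue_mul_eq_sq_of_mul_eq_sq K v ρ (hunit d hd) (unitO m hm) hz'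
  rw [hρ, resO m hm, mul_one] at hrr
  exact ⟨r, hr, hrr⟩

end WeierstrassCurve

end
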